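import Mathlib
import HarnessLib
import HarnessLib.Audit
import Summits.HodgeConjecture.HodgeConjecture.Statement
import Literature.AlgebraicGeometry.Motives.FamiliesVHS
import Literature.AlgebraicGeometry.Motives.BettiCycleClass
import Literature.AlgebraicGeometry.Motives.BettiRealizationSummitCompatible
import Literature.Barriers.HodgeConjecture.HodgeLocusAlgebraic
import HarnessLib.Audit.Status.Attr

/-!
Route: ShortHodgeVectors

Route ShortHodgeVectors — "short Hodge vectors are explained" (idea card
short-hodge-vectors-tadpole). DECLARED SECTOR ROUTE.

Thesis X (Target `ShortVectorsAlgebraic`, asymptotic sector form of HC): for every p >= 1 and every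
b there is d0 = d0(p,b) such that on every smooth hypersurface X of degree d >= d0 in P^{2p+1}_C,
every integral Hodge class x in H^{2p}(X,Z) which is primitive (x.h = 0) and SHORT, (-1)^p int_X x^2
<= b d^p, is a rational combination of classes of algebraic cycles. NORM is the complexity measure:
the window [0, b d^p] contains the classes of differences of p-planes and of all p-cycles of degree
< ~b/2, and — if the engine below holds — nothing else.

Lean (elaborates, folder Sketch.lean rc 0; hypothesis structure B : BettiCycleData as in
Literature.AlgebraicGeometry.Motives.BettiCycleClass):
ShortVectorsAlgebraic := ∀ B p, 1 ≤ p → ∀ b, ∃ d₀, ∀ d ≥ d₀, ∀ X (hX : IsSmoothProjective (2p) X) (e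
: ProjectiveEmbedding X), e.n = 2p+1 → ∀ H (hyperplane: coheight 1, tr_{P}(cl(H)^{2p+1}) = 1),
tr_X(η^{2p}) = d → ∀ x ∈ B.integralHodgeClasses hX p, x̂ ∪ η = 0 → (-1)^p tr_X(x̂ ∪ x̂) ≤ b d^p → x̂
∈ B.W.algebraicClasses X p   (x̂ = isoObj⁻¹ x_Q).

ENGINE (crux 1, `NormCodimInequality`, the mathematised TADPOLE CONJECTURE of F/M-theory flux
compactification, BenaBlabackGranaLust2021 / HodgeG4Weighted2026 sec.2.4 Conj.1, refined universal
form): for every smooth projective family f : 𝒳 → S of relative dimension 2p over C, every s and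
every non-zero primitive integral Hodge class u on 𝒳_s, the Hodge locus of u has an irreducible
component through (s,u) of codimension <= 2·(-1)^p ∫ u ∪ u ("a short flux stabilises few moduli").
Dictionary: G_4 flux ↦ u; tadpole charge (1/2)∫G∧G ↦ norm/2; number of stabilised complex-structure
moduli ↦ codimension of the Hodge-locus component = rank of the IVHS map ξ ↦ ∇_ξ u; supersymmetric
Minkowski vacuum locus ↦ Hodge locus (BraunValandro2021). CHAIN: crux 1 + Otwinowska's theorem
(Otwinowska2004VarietesHodge Thm 1/Cor 1: for d >= C b^a every class whose Hodge variety has codim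
<= b d^p/p! lies in the span of classes of p-dimensional subvarieties of degree < (1+ε)b, hence is
algebraic) ⟹ X. Crux 2 (`JacobianRankLowerBound`, generalised Green–Otwinowska bound rank(·P : R_d →
R_{(p+1)(d-2)+d}) >= C(d+p,p) - (p+1)^2 for all d >= 3) is the non-asymptotic infinitesimal input
(with crux 1 it gives the HODGE SYSTOLE bound: no non-zero primitive integral Hodge class of norm <
[C(d+p,p)-(p+1)^2]/2 on any smooth X_d, e.g. >= 10 on sextic fourfolds). Crux 3
(`RigidPairsAreLong`): an isolated point (X,u) of the Hodge locus has norm >= dim_s S / 2 — the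
pruning lemma wanted by the special-point cruxes of cards bku-finite-tree-of-flavours /
two-attractor-transcendence-test.

FRAME #1 (Assembly `NormCodimInequality → JacobianRankLowerBound → RigidPairsAreLong →
ShortVectorsAlgebraic → HodgeConjecture`) is NOT claimed provable: it records the residual (long
vectors, rigid pairs, non-hypersurfaces) that this sector route does not attack. The route's
deliverables are X, the systole bound, the pruning lemma, and a refutation programme for crux 1
(exact Fermat computations).

Rationale: WHY THIS LINE. Cross-field transplant with an explicit, line-by-line checkable dictionary (flux ↦
integral (p,p)-class, tadpole ↦ norm, stabilised moduli ↦ codimension of the Hodge locus = rank of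
the IVHS map; BraunValandro2021, BakkerGrimmSchnellTsimerman2021): the physicists' tadpole
conjecture (BenaBlabackGranaLust2021; proved in all strict asymptotic regimes by
GranaGrimmHeisteegHerraezPlauschinn2022 via the multi-variable sl2-orbit theorem; stated verbatim as
a Hodge-theoretic conjecture in HodgeG4Weighted2026 sec.2.4 Conj.1) is a NORM–CODIMENSION inequality
for Hodge loci. Chained with the algebraic-geometry classification of small-codimension components
(Green1989NLComponents, Voisin1989NLPetiteCodim, Otwinowska2002, Otwinowska2002Compositio,
Otwinowska2004VarietesHodge) it yields an HC theorem of a new shape: "the shortest Hodge vectors are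
the classes of the simplest subvarieties" — HC in a norm window on every smooth hypersurface of
large degree, plus a Hodge-systole bound and "rigid Hodge classes are long". Imported:
flux-compactification heuristics (string theory) as a conjecture; IVHS/Jacobian rings
(Carlson–Griffiths, VoisinHodgeII2003 ch.5–6) and Hilbert-function asymptotics (Otwinowska) as the
proof technology. For cycle classes the inequality is Riemann–Roch (codim NL(W) <= h^1(N_W); for a
plane in a sextic fourfold 19 = P.P - 2), which is why C = 2 has margin ~2x on all effective
examples (sextic: planes 19/750, two planes 38/40, 38/42, 35/50; surfaces: 2d-6 vs 2d-4); the
conjecture's content is the non-effective short classes at special (CM) points — exactly where HC is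
open.
RANKED CRUXES. r2 NormCodimInequality (engine; pointwise, sheet-pinned form over GeometricVHSData +
BettiCycleData, lattice normalised to H^{2p}(X_s,Z)/tors, norm = cup square of the primitive class;
why it may fail: an interior CM point with a short non-effective class whose locus is deep —
Aoki–Shioda classes on Fermat, Weil classes; refined C=2 may be too small even if some C(p) works).
r3 JacobianRankLowerBound (p=1 = Green 1988/1989; d >> p = Otwinowska 2002; open for small d, p >=
2, e.g. sextic fourfolds; why it may fail: anomalous/non-reduced tangent spaces at Fermat,
Movasati2022HodgeLocus, DuquefrancoVillaflorloyola2023, Kloosterman2025). r4 RigidPairsAreLong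
(corollary-shaped of r2 but independently attackable/refutable: general Hodge cycles on Fermat-type
CY fourfolds, HodgeG4Weighted2026 sec.5; why it may fail: a CM hypersurface with a rigid class of
norm < h^{p+1,p-1}/2). r0 Target ShortVectorsAlgebraic. r1 Assembly = sector frame (open residual,
not claimed).
SUPPORT (filed informally after open): glue r2 ∧ Otwinowska2004 Thm1 ⟹ X (provable once the fact is
vendored; cite item filed); EffectiveTadpole = r2 for differences of smooth effective cycles via
h^1(N) and HRR (provable deformation theory, Bloch1972Semiregularity); E3 = exact Fermat-sextic test
of r2/r3 (kit: Hodge lattice of the Fermat sextic fourfold via AljovinMovasatiVillaflor2019, ranks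
of ·P_λ : R_6 → R_14).
KILL CRITERIA. (i) One pair (s,u) violating r2 with certified norm and certified codimension (Fermat
tables: Movasati2022HodgeLocus, Villaflorloyola2021) closes the route refuted:NormCodimInequality
unless a restatement with C = C(p) survives the same table (then restate once; a second table kill
closes). (ii) A primitive integral Hodge class of norm < 10 on a smooth sextic fourfold (systole
test) refutes r2 ∧ r3 jointly. (iii) r3 false at (d,p) = (6,2) demotes the non-asymptotic half;
X_asym survives on Otwinowska alone.
NOT DECOMPOSED YET. The explanation layers beyond Otwinowska's asymptotics (classification of
components of codim <= 100 for sextic fourfolds = the physics benchmark); the interior proof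
strategy for r2 (integrality enters only through shortness: lattice reduction of u into few
elementary vectors with O(1)-rank contraction maps); CY-fourfold families in toric ambients; abelian
fourfolds (Weil loci, codim 6) as calibration.
NOVELTY/BARRIERS: see the dedicated sections (searched 2026-08-15: lit search/vsearch, zbMATH
au:Otwinowska, galaxy (saturated), held texts arXiv:2606.05530 pp.1-6, arXiv:math/0401092 pp.1-3,
VoisinHodgeII2003 pp.148-149, 170-171).

Novelty: NEAREST PRIOR ART (searched 2026-08-15: `lit search` local+zbMATH (au:Otwinowska, 12 rows), `lit
vsearch` "lower bound self-intersection primitive Hodge class hypersurface / NL codimension vs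
self-intersection" (hits: VoisinHodgeII2003 pp.147-149, Green–Murre–Voisin CIME p.150 — the
classical NL bounds, no norm statements), `lit galaxy search "tadpole conjecture Noether-Lefschetz"
--star all` (0 rows; pdf star saturated), held texts read: arXiv:2606.05530 pp.1-6,
arXiv:math/0401092 pp.1-3, VoisinHodgeII2003 pp.148-149,170-171; plus the triage refuter's reads of
arXiv:2009.11873 pp.8,14, arXiv:2211.11405, arXiv:2312.12363).
(1) The ENGINE is in print as a physics conjecture: BenaBlabackGranaLust2021 = arXiv:2010.10519
(tadpole conjecture, K3xK3), GranaGrimmHeisteegHerraezPlauschinn2022 = arXiv:2204.05331 (asymptotic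
proof), HodgeG4Weighted2026 = arXiv:2606.05530 sec.2.4 Conj.1 verbatim "codim_B(V_{aG}) <= C
Q(aG,aG); refined: C universal", BraunValandro2021 = arXiv:2009.11873 (vacuum locus = NL locus,
stabilised moduli = codimension), BakkerGrimmSchnellTsimerman2021 = arXiv:2112.06995 (finiteness, no
inequality). (2) The CLASSIFICATION side: Green1989NLComponents, Voisin1989NLPetiteCodim (d-3,
2d-7), Otwinowska2002 + Otwinowska2002Compositio + Otwinowska2004VarietesHodge = arXiv:math/0401092
(small codimension ⟹ spanned by low-degree p-folds ⟹ algebraic, d >> b). (3) Fermat-side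
computations: Movasati2022HodgeLocus = arXiv:2211.11405, Villaflorloyola2021, DuquefrancoVillaflorl  [refs: 2606.05530, math/0401092, 2009.11873, 2211.11405, 2312.12363, 2010.10519, 2204.05331, 2112.06995, VoisinHodgeII2003, BenaBlabackGranaLust2021, GranaGrimmHeisteegHerraezPlauschinn2022, BraunValandro2021, BakkerGrimmSchnellTsimerman2021, Otwinowska2002, Villaflorloyola2021, DuquefrancoVillaflorloyola2023, AljovinMovasatiVillaflor2019, Kloosterman2025]

Barriers (technique_class: norm-codimension-inequality, noether-lefschetz-locus, ivhs): technique_class: norm-codimension-inequality, infinitesimal-variation-of-hodge-structure,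
noether-lefschetz-locus, jacobian-ring, flux-compactification-dictionary
- Literature.Barriers.HodgeConjecture.CattaniDeligneKaplan1995_hodgeLocus_algebraicFor: USED
POSITIVELY, not evaded — it is a hypothesis of cruxes NormCodimInequality / RigidPairsAreLong (the
bounded-norm Hodge loci are Zariski closed with finitely many components, which is what makes "a
component through (s,u) of codimension <= 2 norm" meaningful and CDK-finite per norm); the route
never tries to produce a non-algebraic locus (the barrier blocks refutations via transcendental
loci; we are on the proof/structure side), and the open field-of-definition question is not touched.
- Literature.Barriers.HodgeConjecture.Voisin2003_generalHypersurface_noIntegralClassInF (normal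
functions / general hypersurface carries no class): consistent — the general hypersurface has empty
Hodge locus and our statements are vacuous there; everything happens ON special members; no
Abel–Jacobi, Lefschetz-pencil or Jacobi-inversion argument is used (IVHS ranks and Hilbert functions
instead).
- Literature.Barriers.HodgeConjecture.Grothendieck1969_generalHodgeConjecture_false (classwise
Hodge-level/coniveau criteria fail): not engaged — the criterion here is metric (norm of an INTEGRAL
class vs codimension of its locus in a family), and algebraicity is concluded only through
Otwinowska's classification theorem, never from level data of the cl

History (route lifecycle, newest last):
- 2026-08-15T16:20:30Z · rev 3: restated ShortVectorsAlgebraic (stmt-HodgeConjecture-3342) — repair (planner rbadge g2): ShortVectorsAlgebraic restated 1:1 with the honesty guard 'forall B : BettiCycleData, B.toBettiHodgeData.IsSummitCompatible -> ...' (planner-rbadge-HodgeConjecture-ShortHodgeVecto-f199f545-g2-0)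
- 2026-08-15T16:21:24Z · rev 4: restated NormCodimInequality (stmt-HodgeConjecture-3343) — repair (planner rbadge g2): NormCodimInequality restated 1:1 per refuter bd53e379 (14:02:18Z: hypothesis structure not pinned; exotic fiberIso-twist datum on Le (planner-rbadge-HodgeConjecture-ShortHodgeVecto-f199f545-g2-0)
- 2026-08-15T16:23:47Z · rev 5: restated RigidPairsAreLong (stmt-HodgeConjecture-3345) — repair (planner rbadge g2): RigidPairsAreLong restated 1:1 per refuter bd53e379 (14:02:42Z; shape certificate RigidPairsPointBase.lean: over S = Spec C[[t_1..t_ (planner-rbadge-HodgeConjecture-ShortHodgeVecto-f199f545-g2-0)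

sub-problem: HodgeConjecture · status: blocked · opened planner-plancard-HodgeConjecture-HodgeConject-ed573727-0 2026-08-15T11:16:54Z · rev 5 · ledger route-HodgeConjecture-ShortHodgeVectors
GENERATED by the gate from the ledger (D-0016/17). Provers cite these decls: `theorem foo : Summit.HodgeConjecture.HodgeConjecture.Theses.ShortHodgeVectors.<Decl> := …` in Summits/HodgeConjecture/HodgeConjecture/Theorems/<Name>.lean.
-/

namespace Summit.HodgeConjecture.HodgeConjecture.Theses.ShortHodgeVectors

open scoped BigOperators Topology Manifold Classical MeasureTheory ProbabilityTheory Matrix InnerProductSpace ComplexConjugate ContinuousMap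
open Filter Set Function TopologicalSpace MeasureTheory

attribute [summit_statement] _root_.HodgeConjecture

-- earlier ShortVectorsAlgebraic (stmt-HodgeConjecture-3342, replaced 2026-08-15T16:20:30Z -> stmt-HodgeConjecture-10655): retired by None — ∀ (B : Literature.AlgebraicGeometry.Motives.BettiCycleData) (p : ℕ), 1 ≤ p → ∀ b : ℕ, ∃ d₀ : ℕ, ∀ d : ℕ, d₀ ≤ d → ∀ (X : Literature.AlgebraicGeometry.Motives.SchemeOver ℂ) (hX : Literature.AlgebraicGeometry.Motives.IsSmoothProjective (2 * p) X) (e : Literature.A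
/-- item stmt-HodgeConjecture-10655 · target · rank 0 · open · by planner
why it might fail: Only via the engine: a short (norm <= b d^p) non-effective integral Hodge class at a CM point of X_d, d large, on a Hodge-locus component deeper than 2*norm escapes Otwinowska's range; and Otwinowska 2004 Thm 1 (lambda in H(W)) is an unrefereed preprint (JAG 2003 alone gives no algebraicity).
sources: Otwinowska2004VarietesHodge, arXiv:math/0401092, Otwinowska2002, arXiv:2606.05530, BenaBlabackGranaLust2021
[target] Thesis X, asymptotic SECTOR form of HC on even-dimensional hypersurfaces: for every p >= 1
and b there is d0(p,b) such that every primitive integral Hodge class x on a smooth hypersurface X_d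
in P^{2p+1}, d >= d0, with (-1)^p int x^2 <= b d^p is rationally algebraic. Follows from
NormCodimInequality + Otwinowska's theorem (Otwinowska2004VarietesHodge = arXiv:math/0401092 Thm 1 /
Cor 1, d >= C b^a) via support GlueOtwinowskaShortVectors. Typed over B : BettiCycleData GUARDED by
B.toBettiHodgeData.IsSummitCompatible (Motives/BettiRealizationSummitCompatible: (a) B-Hodge classes
of H^{2p} = rational (p,p)-classes of X(C), (b) complexified Q.A^p_B = HodgeTheory.algebraicClasses,
(c) Hodge models exist) — repair 2026-08-15 of the unguarded 'forall B' (refuter bd53e379: at the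
re-decoration B.pureEven the Hodge hypothesis evaporated, certificate ShortVectorsNoHodge.lean);
rest verbatim: X smooth projective of dim 2p with a closed embedding e into P^{2p+1} (a
hypersurface), H a hyperplane (coheight 1 and tr_P(cl(H)^{2p+1}) = 1), degree d = tr_X(eta^{2p}), x
integral Hodge (B.integralHodgeClasses), primitive (x^ cup eta = 0), norm (-1)^p tr_X(x^ cup x^) <=
b d^p, conclusion x^ in -/
@[route_item "route-HodgeConjecture-ShortHodgeVectors", crux]
def ShortVectorsAlgebraic : Prop :=
  ∀ (B : Literature.AlgebraicGeometry.Motives.BettiCycleData), B.toBettiHodgeData.IsSummitCompatible → ∀ (p : ℕ), 1 ≤ p → ∀ b : ℕ, ∃ d₀ : ℕ, ∀ d : ℕ, d₀ ≤ d → ∀ (X : Literature.AlgebraicGeometry.Motives.SchemeOver ℂ) (hX : Literature.AlgebraicGeometry.Motives.IsSmoothProjective (2 * p) X) (e : Literature.AlgebraicGeometry.Motives.ProjectiveEmbedding X), e.n = 2 * p + 1 → ∀ (H : (Literature.AlgebraicGeometry.Motives.projectiveSpace e.n ℂ).left), Order.coheight H = 1 → B.W.trace (Literature.AlgebraicGeometry.Motives.projectiveSpace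 e.n ℂ) e.n (B.W.pow (Literature.AlgebraicGeometry.Motives.projectiveSpace e.n ℂ) (B.W.cycleClass (Literature.AlgebraicGeometry.Motives.projectiveSpace e.n ℂ) 1 H) e.n) = 1 → B.W.trace X (2 * p) (B.W.hyperplanePow e H (2 * p)) = d → ∀ x ∈ B.integralHodgeClasses hX p, B.W.cup (rfl : 2 * p + 2 = 2 * p + 2) ((B.isoObj X (2 * p)).symm (B.intToRat X (2 * p) x)) (B.W.hyperplaneClass e H) = 0 → (-1 : ℚ) ^ p * B.W.trace X (2 * p) (B.W.cup (two_mul (2 * p)).symm ((B.isoObj X (2 * p)).symm (B.intToRat X (2 * p) x)) ((B.isoObj X (2 * p)).symm (B.intToRat X (2 * p) x))) ≤ (b : ℚ) * (d : ℚ) ^ p → (B.isoObj X (2 * p)).symm (B.intToRat X (2 * p) x) ∈ B.W.algebraicClasses X p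

-- earlier NormCodimInequality (stmt-HodgeConjecture-3343, replaced 2026-08-15T16:21:24Z -> stmt-HodgeConjecture-10701): retired by None — ∀ (B : Literature.AlgebraicGeometry.Motives.BettiCycleData) (𝒳 S : Literature.AlgebraicGeometry.Motives.SchemeOver ℂ) (f : 𝒳 ⟶ S) (p : ℕ) (D : Literature.AlgebraicGeometry.Motives.GeometricVHSData B.toBettiHodgeData f (2 * p) (2 * p)), (∀ s : Literature.AlgebraicG
/-- item stmt-HodgeConjecture-10701 · crux · rank 2 · open · by planner
why it might fail: Short non-effective classes at CM points (Aoki-Shioda on the Fermat sextic, Weil classes) may lie on components deeper than 2*norm; non-reduced loci stabilise more moduli at higher order than the Hessian rank (LG 1^9, fake linear cycles); quotients X/G divide norms by |G|: universal C=2 is fragile.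
sources: BenaBlabackGranaLust2021, arXiv:2010.10519, arXiv:2606.05530, GranaGrimmHeisteegHerraezPlauschinn2022, BraunValandro2021, arXiv:2210.03706
[crux] ENGINE = mathematised tadpole conjecture (BenaBlabackGranaLust2021 = arXiv:2010.10519;
HodgeG4Weighted2026 = arXiv:2606.05530 sec.2.4 Conj.1, refined universal constant C = 2: 'a flux of
tadpole Q stabilises at most 4Q moduli'). Setting (REPAIRED 2026-08-15 after refuter bd53e379): B :
BettiCycleData guarded by B.toBettiHodgeData.IsSummitCompatible; f : X -> S a smooth projective
family of relative dimension 2p over C with S LOCALLY OF FINITE TYPE; D : GeometricVHSData of weight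
2p PINNED TO GAUSS-MANIN by tube restrictions (for every t0 in S(C) a neighbourhood V such that
restriction H^{2p}(f^{-1}(V)(C);Q) -> H^{2p}(X_t(C);Q) is onto for t in V and D's parallel transport
along paths inside V, conjugated by fiberIso and B.isoObj, carries res_t x to res_t' x — Ehresmann
when S is smooth; this excludes the exotic fiberIso-twists of the 14:02Z note, under which the Hodge
locus collapsed to {s}); integral lattice normalised to H^{2p}(X_s,Z)/tors; CDK algebraicity of
bounded-norm loci assumed (a theorem for the honest datum). CLAIM: for every s and every non-zero
integral Hodge class u at s, primitive for some projective embedding of the fibre, there is an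
irreducible Zariski-clo -/
@[route_item "route-HodgeConjecture-ShortHodgeVectors", crux]
def NormCodimInequality : Prop :=
  open Literature.AlgebraicGeometry.Motives Literature.AlgebraicTopology.SingularHomology in ∀ (B : BettiCycleData), B.toBettiHodgeData.IsSummitCompatible → ∀ (𝒳 S : SchemeOver ℂ) (f : 𝒳 ⟶ S) (p : ℕ) (D : GeometricVHSData B.toBettiHodgeData f (2 * p) (2 * p)), AlgebraicGeometry.LocallyOfFiniteType S.hom → (∀ t₀ : ComplexPoints S, ∃ V ∈ 𝓝 t₀, ∀ (t : ComplexPoints S) (ht : t ∈ V) (t' : ComplexPoints S) (ht' : t' ∈ V) (γ : Path t t'), (∀ τ : unitInterval, γ τ ∈ V) → Function.Surjective (fun x : singularCohomology ℚ ℚ {y : ComplexPoints 𝒳 // ∃ t ∈ V, ∃ x : ComplexPoints (fiberOver f t), AlgPoints.map (fiberι f t) x = y} (2 * p) => (singularCohomology.map ℚ ℚ (⟨fun x => ⟨AlgPoints.map (fiberι f t) x, t, ht, x, rfl⟩, (AlgPoints.mapContinuous (L := ℂ) (fiberι f t)).continuous.subtype_mk _⟩ : C(ComplexPoints (fiberOver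 f t), {y : ComplexPoints 𝒳 // ∃ t ∈ V, ∃ x : ComplexPoints (fiberOver f t), AlgPoints.map (fiberι f t) x = y})) (2 * p)).hom x) ∧ ∀ x : singularCohomology ℚ ℚ {y : ComplexPoints 𝒳 // ∃ t ∈ V, ∃ x : ComplexPoints (fiberOver f t), AlgPoints.map (fiberι f t) x = y} (2 * p), B.isoObj (fiberOver f t') (2 * p) (D.fiberIso t' (D.V.transport ⟦γ⟧ ((D.fiberIso t).symm ((B.isoObj (fiberOver f t) (2 * p)).symm ((singularCohomology.map ℚ ℚ (⟨fun x => ⟨AlgPoints.map (fiberι f t) x, t, ht, x, rfl⟩, (AlgPoints.mapContinuous (L := ℂ) (fiberι f t)).continuous.subtype_mk _⟩ : C(ComplexPoints (fiberOver f t), {y : ComplexPoints 𝒳 // ∃ t ∈ V, ∃ x : ComplexPoints (fiberOver f t), AlgPoints.map (fiberι f t) x = y})) (2 * p)).hom x))))) = (singularCohomology.map ℚ ℚ (⟨fun x => ⟨AlgPoints.map (fiberι f t') x, t', ht', x, rfl⟩, (AlgPoints.mapContinuous (L := ℂ) (fiberι f t')).continuous.subtype_mk _⟩ : C(ComplexPoints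 (fiberOver f t'), {y : ComplexPoints 𝒳 // ∃ t ∈ V, ∃ x : ComplexPoints (fiberOver f t), AlgPoints.map (fiberι f t) x = y})) (2 * p)).hom x) → (∀ s : ComplexPoints S, Set.range (fun u : D.VZ.fiber s => D.fiberIso s (D.toRat s u)) = Set.range (fun x : bettiCohomologyInt (fiberOver f s) (2 * p) => (B.isoObj (fiberOver f s) (2 * p)).symm (B.intToRat (fiberOver f s) (2 * p) x))) → Literature.Barriers.HodgeConjecture.CattaniDeligneKaplan1995_hodgeLocus_algebraicFor B.toBettiHodgeData D → ∀ (s : ComplexPoints S) (u : D.VZ.fiber s), u ≠ 0 → D.IsHodgeAt s p u → (∃ (e : ProjectiveEmbedding (fiberOver f s)) (H : (projectiveSpace e.n ℂ).left), Order.coheight H = 1 ∧ B.W.cup (rfl : 2 * p + 2 = 2 * p + 2) (D.fiberIso s (D.toRat s u)) (B.W.hyperplaneClass e H) = 0) → ∃ (Z Bad : Set S.left), IsClosed Z ∧ IsClosed Bad ∧ IsIrreducible Z ∧ ¬ Z ⊆ Bad ∧ s.pt ∈ Z ∧ (∀ z : S.left, IsGenericPoint z Z → ∃ c : ℕ, Order.coheight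 z = (c : ℕ∞) ∧ (c : ℚ) ≤ 2 * ((-1 : ℚ) ^ p * B.W.trace (fiberOver f s) (2 * p) (B.W.cup (two_mul (2 * p)).symm (D.fiberIso s (D.toRat s u)) (D.fiberIso s (D.toRat s u))))) ∧ ∃ V : ∀ t : ComplexPoints S, Set (D.VZ.fiber t), (∀ t : ComplexPoints S, t.pt ∈ Z → ∀ v ∈ V t, D.IsHodgeAt t p v) ∧ (∀ (t t' : ComplexPoints S) (γ : Path t t'), (∀ τ : unitInterval, (γ τ).pt ∈ Z \ Bad) → ∀ v ∈ V t, D.VZ.transport ⟦γ⟧ v ∈ V t') ∧ (∃ (t₀ : ComplexPoints S) (v₀ : D.VZ.fiber t₀) (γ : Path t₀ s), v₀ ∈ V t₀ ∧ (∀ τ : unitInterval, τ < 1 → (γ τ).pt ∈ Z \ Bad) ∧ D.VZ.transport ⟦γ⟧ v₀ = u)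

/-- item stmt-HodgeConjecture-3344 · crux · rank 3 · open · by planner
why it might fail: For p>=2, small d, non-Fermat F this is Otwinowska's open Hilbert-function conjecture (Crelle 2002: c.i. minimal among Gorenstein quotients of S/J), of EGH type; known only for p=1 (Green), d>>p (Otwinowska), Fermat F (Movasati 2017). One smooth sextic fourfold with codim(J:P)_6 < 19 kills it.
sources: Green1989NLComponents, Voisin1989NLPetiteCodim, Otwinowska2002Crelle, doi:10.1515/crll.2002.038, Movasati2017GMCD, arXiv:1411.1766
[crux] Generalised Green-Otwinowska infinitesimal bound, all degrees: for a smooth form F of degree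
d >= 3 in 2p+2 variables (p >= 1), Jacobian ideal J, and every P homogeneous of degree (p+1)(d-2)
not in J (i.e. a non-zero class in R_{(p+1)(d-2)} = H^{p,p}_prim(X_F) by Griffiths), the
multiplication map .P : S_d -> R_{(p+1)(d-2)+d} (= the IVHS map, VoisinHodgeII2003 Thm 6.13/6.24
p.170) has rank >= binom(d+p,p) - (p+1)^2 = codim of the locus of hypersurfaces containing a
p-plane; typed as dim{G in S_d : G P in J} + tau_1 <= dim S_d = binom(d+2p+1,2p+1). Known: p = 1 all
d (Green 1988/Green1989NLComponents, Voisin1989NLPetiteCodim: codim >= d-3, VoisinHodgeII2003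
p.149); p >= 2 and d >> p (Otwinowska2002Compositio). OPEN for small d, p >= 2 (sextic fourfolds:
rank(.P : S_6 -> R_14) >= 19 for all P in R_8 minus 0). Role: with NormCodimInequality it gives the
Hodge-SYSTOLE bound (no primitive integral Hodge class of norm < tau_1(d,p)/2, e.g. >= 10 on sextic
fourfolds) and the non-asymptotic first layer. Cheap test: ranks for random/special P at the Fermat
sextic (kit). -/
@[route_item "route-HodgeConjecture-ShortHodgeVectors", crux]
def JacobianRankLowerBound : Prop :=
  ∀ (p d : ℕ), 1 ≤ p → 3 ≤ d → ∀ (F : MvPolynomial (Fin (2 * p + 2)) ℂ), F.IsHomogeneous d → (∀ z : Fin (2 * p + 2) → ℂ, z ≠ 0 → MvPolynomial.eval z F = 0 → ∃ j, MvPolynomial.eval z (MvPolynomial.pderiv j F) ≠ 0) → ∀ (P : MvPolynomial (Fin (2 * p + 2)) ℂ), P.IsHomogeneous ((p + 1) * (d - 2)) → P ∉ Ideal.span (Set.range fun j : Fin (2 * p + 2) => MvPolynomial.pderiv j F) → Module.finrank ℂ ↥(((Ideal.span (Set.range fun j : Fin (2 * p + 2) => MvPolynomial.pderiv j F)).restrictScalars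 ℂ).comap (LinearMap.mulRight ℂ P) ⊓ MvPolynomial.homogeneousSubmodule (Fin (2 * p + 2)) ℂ d) + (Nat.choose (d + p) p - (p + 1) ^ 2) ≤ Nat.choose (d + 2 * p + 1) (2 * p + 1)

-- earlier RigidPairsAreLong (stmt-HodgeConjecture-3345, replaced 2026-08-15T16:23:47Z -> stmt-HodgeConjecture-10782): retired by None — ∀ (B : Literature.AlgebraicGeometry.Motives.BettiCycleData) (𝒳 S : Literature.AlgebraicGeometry.Motives.SchemeOver ℂ) (f : 𝒳 ⟶ S) (p : ℕ) (D : Literature.AlgebraicGeometry.Motives.GeometricVHSData B.toBettiHodgeData f (2 * p) (2 * p)), (∀ s : Literature.AlgebraicGeo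
/-- item stmt-HodgeConjecture-10782 · crux · rank 4 · open · by planner
why it might fail: A CM point with a rigid (all-orders stabilising) integral Hodge class of norm < dim_s S/2: LG 1^9 tadpole-saturating fluxes may stabilise all moduli at higher order (arXiv:2210.03706); one general Hodge cycle on a Fermat-type CY fourfold (arXiv:2606.05530 sec.5) below dim S/2 kills it.
sources: arXiv:2606.05530, BenaBlabackGranaLust2021, BakkerGrimmSchnellTsimerman2021, arXiv:2210.03706, arXiv:2312.12363, Movasati2022HodgeLocus
[crux] Rigid pairs are long (the tadpole conjecture at full stabilisation; the pruning lemma wanted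
by the special-point cruxes of cards bku-finite-tree-of-flavours /
two-attractor-transcendence-test). Same REPAIRED setting as NormCodimInequality (2026-08-15, after
refuter bd53e379): B guarded by IsSummitCompatible, S locally of finite type over C (kills the Spec
C[[t_1..t_5]] counterexample of certificate RigidPairsPointBase.lean: over a finite-type base an
isolated C-point has the right coheight), D pinned to Gauss-Manin by tube restrictions (kills the
exotic fiberIso twist making every pair 'isolated'), lattice normalised, CDK assumed. CLAIM: if
(s,u) is an ISOLATED point of the Hodge locus (u a non-zero primitive integral Hodge class at s; no
t != s in a neighbourhood U, reached by a path inside U, keeps the transported u Hodge — 'all moduli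
stabilised', a general Hodge cycle in the sense of Movasati / Braun et al.), then the local
dimension of S at s (coheight of the closed point s.pt) is <= 2 (-1)^p tr(u cup u): an isolated
Hodge class has norm >= dim_s S / 2, e.g. >= 213 on a complete family of sextic fourfolds (426
moduli). Implied by NormCodimInequality (Z = {s}); independ -/
@[route_item "route-HodgeConjecture-ShortHodgeVectors", crux]
def RigidPairsAreLong : Prop :=
  open Literature.AlgebraicGeometry.Motives Literature.AlgebraicTopology.SingularHomology in ∀ (B : BettiCycleData), B.toBettiHodgeData.IsSummitCompatible → ∀ (𝒳 S : SchemeOver ℂ) (f : 𝒳 ⟶ S) (p : ℕ) (D : GeometricVHSData B.toBettiHodgeData f (2 * p) (2 * p)), AlgebraicGeometry.LocallyOfFiniteType S.hom → (∀ t₀ : ComplexPoints S, ∃ V ∈ 𝓝 t₀, ∀ (t : ComplexPoints S) (ht : t ∈ V) (t' : ComplexPoints S) (ht' : t' ∈ V) (γ : Path t t'), (∀ τ : unitInterval, γ τ ∈ V) → Function.Surjective (fun x : singularCohomology ℚ ℚ {y : ComplexPoints 𝒳 // ∃ t ∈ V, ∃ x : ComplexPoints (fiberOver f t), AlgPoints.map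 (fiberι f t) x = y} (2 * p) => (singularCohomology.map ℚ ℚ (⟨fun x => ⟨AlgPoints.map (fiberι f t) x, t, ht, x, rfl⟩, (AlgPoints.mapContinuous (L := ℂ) (fiberι f t)).continuous.subtype_mk _⟩ : C(ComplexPoints (fiberOver f t), {y : ComplexPoints 𝒳 // ∃ t ∈ V, ∃ x : ComplexPoints (fiberOver f t), AlgPoints.map (fiberι f t) x = y})) (2 * p)).hom x) ∧ ∀ x : singularCohomology ℚ ℚ {y : ComplexPoints 𝒳 // ∃ t ∈ V, ∃ x : ComplexPoints (fiberOver f t), AlgPoints.map (fiberι f t) x = y} (2 * p), B.isoObj (fiberOver f t') (2 * p) (D.fiberIso t' (D.V.transport ⟦γ⟧ ((D.fiberIso t).symm ((B.isoObj (fiberOver f t) (2 * p)).symm ((singularCohomology.map ℚ ℚ (⟨fun x => ⟨AlgPoints.map (fiberι f t) x, t, ht, x, rfl⟩, (AlgPoints.mapContinuous (L := ℂ) (fiberι f t)).continuous.subtype_mk _⟩ : C(ComplexPoints (fiberOver f t), {y : ComplexPoints 𝒳 // ∃ t ∈ V, ∃ x : ComplexPoints (fiberOver f t), AlgPoints.map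 (fiberι f t) x = y})) (2 * p)).hom x))))) = (singularCohomology.map ℚ ℚ (⟨fun x => ⟨AlgPoints.map (fiberι f t') x, t', ht', x, rfl⟩, (AlgPoints.mapContinuous (L := ℂ) (fiberι f t')).continuous.subtype_mk _⟩ : C(ComplexPoints (fiberOver f t'), {y : ComplexPoints 𝒳 // ∃ t ∈ V, ∃ x : ComplexPoints (fiberOver f t), AlgPoints.map (fiberι f t) x = y})) (2 * p)).hom x) → (∀ s : ComplexPoints S, Set.range (fun u : D.VZ.fiber s => D.fiberIso s (D.toRat s u)) = Set.range (fun x : bettiCohomologyInt (fiberOver f s) (2 * p) => (B.isoObj (fiberOver f s) (2 * p)).symm (B.intToRat (fiberOver f s) (2 * p) x))) → Literature.Barriers.HodgeConjecture.CattaniDeligneKaplan1995_hodgeLocus_algebraicFor B.toBettiHodgeData D → ∀ (s : ComplexPoints S) (u : D.VZ.fiber s), u ≠ 0 → D.IsHodgeAt s p u → (∃ (e : ProjectiveEmbedding (fiberOver f s)) (H : (projectiveSpace e.n ℂ).left), Order.coheight H = 1 ∧ B.W.cup (rfl : 2 * p + 2 = 2 * p + 2) (D.fiberIso s (D.toRat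 s u)) (B.W.hyperplaneClass e H) = 0) → (∃ U ∈ 𝓝 s, ∀ t ∈ U, ∀ γ : Path s t, (∀ τ : unitInterval, γ τ ∈ U) → D.IsHodgeAt t p (D.VZ.transport ⟦γ⟧ u) → t = s) → ∃ c : ℕ, Order.coheight s.pt = (c : ℕ∞) ∧ (c : ℚ) ≤ 2 * ((-1 : ℚ) ^ p * B.W.trace (fiberOver f s) (2 * p) (B.W.cup (two_mul (2 * p)).symm (D.fiberIso s (D.toRat s u)) (D.fiberIso s (D.toRat s u))))

-- item stmt-HodgeConjecture-3419 · support · rank 9 · open · by planner — informal only, no Lean statement yet: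
--   [support] EFFECTIVE TADPOLE = Riemann–Roch (provable deformation theory; calibrates the constant of
--   NormCodimInequality): for a smooth projective 2p-fold X in a smooth complete family S and smooth
--   p-dimensional subvarieties W1, W2 of X, the locus of deformations of X to which W_i deforms has
--   codimension <= h^1(N_{W_i/X}) at X (Kodaira / Bloch semiregularity, Bloch1972Semiregularity;
--   VoisinHodgeII2003 Prop 5.19 p.148 for curves on surfaces), hence the Hodge locus of u = [W1] - [W2]
--   has a component through X of codim <= h^1(N_{W1}) + h^1(N_{W2}). For X a Calabi–Yau fourfold and S_i
--   smooth surfac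

-- item stmt-HodgeConjecture-3420 · support · rank 9 · open · by planner — informal only, no Lean statement yet:
--   [support] E3 — EXACT FERMAT TEST of NormCodimInequality / JacobianRankLowerBound / RigidPairsAreLong
--   at (d,p) = (6,2) (kit compute; refuter-grade): (1) Hodge lattice L of the Fermat sextic fourfold
--   x0^6+...+x5^6 (integral primitive Hodge classes; generated over Q by linear cycles and Aoki–Shioda
--   cycles, AljovinMovasatiVillaflor2019 = arXiv:1711.02628) with its intersection form; enumerate all u
--   in L with u.u <= 100 (finite; lattice enumeration). (2) For each such u compute its Griffiths
--   polynomial P_u in R_12 = C[x]/(x_i^5)_12 (periods of linear cycles, Movasati–Villaflor) and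
--   rank(.P_u : R_6

-- item stmt-HodgeConjecture-3423 · support · rank 9 · open · by planner — informal only, no Lean statement yet:
--   [support] GLUE (provable once the fact is vendored): NormCodimInequality ∧ OtwinowskaHodgeVarieties
--   ⟹ ShortVectorsAlgebraic, where OtwinowskaHodgeVarieties is the named Literature fact to be vendored
--   from Otwinowska2004VarietesHodge = arXiv:math/0401092, Thm 1 + Cor 1 (read pp.1-3): Y = P^{2p+1},
--   for every eps > 0 there is C with: if d >= C b^a (a = 2^{2p+1}) and lambda in F^p H^{2p}_ev(X_F) is
--   a non-zero (complex) class whose Hodge variety N_lambda has codim <= b d^p / p!, then lambda lies in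
--   H(W) for a p-dimensional subvariety W of X_F of degree < (1+eps) b; in particular rational such
--   lambd

/-- item stmt-HodgeConjecture-3346 · assembly · rank 1 · open · by planner
[assembly] SECTOR FRAME (D-0019 frame #1, X -> Statement): NormCodimInequality ->
JacobianRankLowerBound -> RigidPairsAreLong -> ShortVectorsAlgebraic -> HodgeConjecture. NOT CLAIMED
PROVABLE and not to be staffed: it records exactly the residual this route does not attack (integral
Hodge classes of norm > b d^p, rigid pairs, varieties other than even-dimensional hypersurfaces).
The route's deliverables are the Target, the systole bound and the pruning lemma; the provable glue
'NormCodimInequality ∧ Otwinowska2004 Thm 1 => ShortVectorsAlgebraic' is filed as a support item. A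
prover should claim this item only with a genuine reduction of HC to the short-vector sector in
hand. -/
@[route_item "route-HodgeConjecture-ShortHodgeVectors", crux]
def Assembly : Prop :=
  NormCodimInequality → JacobianRankLowerBound → RigidPairsAreLong → ShortVectorsAlgebraic → _root_.HodgeConjecture

/-! D-0027 §2.1 — DECIDING THEOREM (planner-authored via `route open/edit --closes-file`; by planner-rbadge-HodgeConjecture-ShortHodgeVecto-f199f545-g2-0 2026-08-15T16:13:18Z):
its hypotheses are this route's items and its conclusion the sub-problem Statement (glue_lint), and it elaborates with this file. -/

@[closes "route-HodgeConjecture-ShortHodgeVectors"] theorem closes (h₀ : ShortVectorsAlgebraic) (h₁ : NormCodimInequality) (h₂ : JacobianRankLowerBound)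
    (h₃ : RigidPairsAreLong) (h₄ : Assembly) : _root_.HodgeConjecture :=
  h₄ h₁ h₂ h₃ h₀

end Summit.HodgeConjecture.HodgeConjecture.Theses.ShortHodgeVectors
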